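import Literature.MathematicalPhysics.QuantumLattice.GrassmannSupportSplit
import Literature.MathematicalPhysics.QuantumLattice.HubbardSectorFieldSubstitution
import HarnessLib

/-!
# The SOURCE-DEGREE filtration of a Grassmann algebra: an ideal stable under the effective-action map of a
# covariance that does not see the sources (BGM 2006, §2.9: the external-field sector)

Topic `MathematicalPhysics/QuantumLattice`; continuation of `GrassmannSupportSplit` (splitting by the support of the monomials),
`GrassmannLinearSubstitution` / `HubbardSectorFieldSubstitution` (`map f`, `kernel_map`, `effAction_map`, `map_genProd_eq_sum`) and `GrassmannEffectiveAction` (`effAction C V`).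
In the multiscale analysis with an EXTERNAL (source) field `φ` (Benfatto–Giuliani–Mastropietro 2006, §2.9 (4.3)–(4.6):
`e^{𝒲(φ)} = ∫P(dψ) e^{-𝒱(ψ) + (φ,ψ)}`, after the fields above scale `h` one is left with `-𝒱^{(h)}(ψ) - ℬ^{(h)}(ψ, φ) - W_R`,
`W_R` collecting the terms of third and higher order in `φ`) the source generators are SPECTATORS — their covariance block is zero —
so a monomial never LOSES a source leg under the integration, and the part of the effective action of source degree `< k`
depends only on the part of the input of source degree `< k`: BGM's remark that `W_R` (≥ 3 sources) never feeds back into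
the terms with ≤ 2 sources, which is what makes the flow of the two-point Schwinger function a closed recursion.  This file
makes that bookkeeping a theorem of the finite Grassmann calculus, for an arbitrary predicate `P` marking the source labels:

* `srcCount P X` — the number of source legs of a label family; `srcGE R P k` — the span of the generator products with AT LEAST
  `k` source legs; `srcTrunc R P k F` — the truncation of `F` to source degree `< k` (kernels `[srcCount < k] · kernel F`,
  `kernel_srcTrunc`);
* `mem_srcGE_iff` — `F ∈ srcGE k` iff every kernel of `F` at a family with `< k` source legs vanishes; `sub_srcTrunc_mem_srcGE`,
  `srcTrunc_eq_srcTrunc_iff` (`srcTrunc k F = srcTrunc k G ↔ F - G ∈ srcGE k`);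
* **`srcGE` is a two-sided ideal** (`mul_mem_srcGE`, `mul_mem_srcGE'`), killed by `constPart` for `k ≥ 1`, and STABLE under:
  the left derivatives in non-source directions, the fermionic Laplacian `Δ_C` and the Gaussian convolution `μ_C ⋆` of every
  covariance vanishing on the sources (`grassmannLaplacian_mem_srcGE`, `gaussConv_mem_srcGE`), the truncated exponential and
  logarithm (`grassmannExp_sub_grassmannExp_mem_srcGE`, `grassmannLog1p_sub_…`), hence
* **`effAction_sub_effAction_mem_srcGE`** — `V - V' ∈ srcGE P k ⟹ effAction C V - effAction C V' ∈ srcGE P k` (and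
  `effPartitionFn C V = effPartitionFn C V'` for `k ≥ 1`), i.e. **`srcTrunc_effAction_srcTrunc`**:
  `srcTrunc k (effAction C (srcTrunc k V)) = srcTrunc k (effAction C V)` — the single-scale step may be run on the input
  truncated to source degree `< k` without changing the output below source degree `k`;
* **`map_mem_srcGE`** / `srcTrunc_map_srcTrunc` — the same for every linear substitution `map f` (possibly between two label
  types, sources `P` on `Γ` and `P'` on `Γ'`) whose matrix sends source generators to source generators only (alive generators may
  acquire source components: the doubling `ψ ↦ ψ + φ`, the dressing `ψ ↦ ψ + Gφ`, a re-sectorisation of the alive legs `⊕ 1`,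
  a rescaling of the sources);
* the profile API for the renormalisation-group consumers: `kernel_srcTrunc_of_lt`, `srcTrunc_mem_evenPart`,
  `sum_filter_norm_kernel_srcTrunc_mul_le`.

Everything is proved; three definitions (`srcCount`, `srcGE`, `srcTrunc`), no named fact.

## Sources
G. Benfatto, A. Giuliani, V. Mastropietro, Ann. Henri Poincaré 7 (2006) 809–898, §2.9 (4.3)–(4.6)
[`BenfattoGiulianiMastropietro2006`]; M. Salmhofer, *Renormalization: An Introduction* (Springer 1999), §4.3 (4.95) (the kernel
expansion), Def. 2.19 (2.102) (the effective action) [`Salmhofer1999`].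
-/

noncomputable section

namespace Literature.MathematicalPhysics.QuantumLattice

open GrassmannAlgebra Finset

/-! ### §1 The number of source legs of a label family -/

section SrcCount

variable {Γ : Type*} (P : Γ → Prop) [DecidablePred P]

/-- The **number of source legs** of the label family `X : Fin m → Γ`: the number of slots `j` with `P (X j)` (BGM 2006, §2.9:
the order in the external field `φ` of a monomial of `ℬ^{(h)}(ψ, φ)`). [cite: BenfattoGiulianiMastropietro2006, §2.9 (4.3)-(4.6)] -/
def srcCount {m : ℕ} (X : Fin m → Γ) : ℕ := (univ.filter fun j => P (X j)).card

/-- `srcCount` as a sum of indicators. [folklore] -/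
private theorem srcCount_eq_sum {m : ℕ} (X : Fin m → Γ) : srcCount P X = ∑ j, if P (X j) then 1 else 0 := by
  rw [srcCount, card_filter]

/-- The empty family has no source legs. [folklore] -/
@[simp] private theorem srcCount_fin_zero (X : Fin 0 → Γ) : srcCount P X = 0 := by
  simp [srcCount]

/-- The source count is invariant under permutations of the slots. [folklore] -/
private theorem srcCount_comp_perm {m : ℕ} (X : Fin m → Γ) (σ : Equiv.Perm (Fin m)) : srcCount P (X ∘ σ) = srcCount P X := by
  rw [srcCount, srcCount]
  exact card_equiv σ fun i => by simp

/-- The source count of a concatenated family is the sum of the source counts. [folklore] -/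
private theorem srcCount_append {m n : ℕ} (X : Fin m → Γ) (Y : Fin n → Γ) : srcCount P (Fin.append X Y) = srcCount P X + srcCount P Y := by
  rw [srcCount_eq_sum, srcCount_eq_sum, srcCount_eq_sum, Fin.sum_univ_add]
  simp only [Fin.append_left, Fin.append_right]

/-- Removing a NON-source leg does not change the source count. [folklore] -/
private theorem srcCount_comp_succAbove_of_not {m : ℕ} (Y : Fin (m + 1) → Γ) (j : Fin (m + 1)) (hj : ¬ P (Y j)) :
    srcCount P (Y ∘ j.succAbove) = srcCount P Y := by
  rw [srcCount_eq_sum, srcCount_eq_sum, Fin.sum_univ_succAbove _ j, if_neg hj, zero_add]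
  rfl

/-- Monotonicity: if every source slot of `X` is a source slot of `X'`, then `srcCount P X ≤ srcCount P' X'`. [folklore] -/
private theorem srcCount_le_of_forall {Γ' : Type*} (P' : Γ' → Prop) [DecidablePred P'] {m : ℕ} (X : Fin m → Γ) (X' : Fin m → Γ')
    (h : ∀ i, P (X i) → P' (X' i)) : srcCount P X ≤ srcCount P' X' := by
  rw [srcCount, srcCount]
  exact card_le_card fun i hi => by
    simp only [mem_filter, mem_univ, true_and] at hi ⊢
    exact h i hi

end SrcCount

/-! ### §2 The source filtration `srcGE k` and its kernel characterisation -/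

section SrcGE

variable (R : Type*) [CommRing R] [Algebra ℚ R] {Γ : Type*} [Fintype Γ] [DecidableEq Γ] (P : Γ → Prop) [DecidablePred P]

/-- **The source filtration**: `srcGE R P k` is the span of the products of generators `ψ(Y₀)⋯ψ(Y_{m-1})` with AT LEAST `k` source
legs (`k ≤ srcCount P Y`) — the terms of order `≥ k` in the external field (BGM 2006, §2.9: `W_R` = the terms of third and higher
order in `φ` is `srcGE 3`). [cite: BenfattoGiulianiMastropietro2006, §2.9 (4.3)-(4.6)] -/
def srcGE (k : ℕ) : Submodule R (GrassmannAlgebra R Γ) :=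
  Submodule.span R {x | ∃ (m : ℕ) (Y : Fin m → Γ), k ≤ srcCount P Y ∧ genProd R Y = x}

omit [Algebra ℚ R] [Fintype Γ] in
/-- Generator products with at least `k` source legs lie in `srcGE k`. [cite: BenfattoGiulianiMastropietro2006, §2.9 (4.3)-(4.6)] -/
theorem genProd_mem_srcGE {k m : ℕ} {Y : Fin m → Γ} (h : k ≤ srcCount P Y) : genProd R Y ∈ srcGE R P k :=
  Submodule.subset_span ⟨m, Y, h, rfl⟩

omit [Algebra ℚ R] [Fintype Γ] in
/-- The filtration is decreasing in `k`. [cite: BenfattoGiulianiMastropietro2006, §2.9 (4.3)-(4.6)] -/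
theorem srcGE_anti {j k : ℕ} (hjk : j ≤ k) : srcGE R P k ≤ srcGE R P j :=
  Submodule.span_mono fun _ ⟨m, Y, h, hx⟩ => ⟨m, Y, hjk.trans h, hx⟩

omit [Algebra ℚ R] [Fintype Γ] in
/-- The delta determinant of two label families with different source counts vanishes (a matching permutation would preserve the
source count). [folklore] -/
private theorem det_deltaMatrix_eq_zero_of_srcCount_ne {m : ℕ} {X Y : Fin m → Γ} (h : srcCount P X ≠ srcCount P Y) :
    (deltaMatrix R X Y).det = 0 := by
  rw [Matrix.det_apply]
  refine sum_eq_zero fun σ _ => ?_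
  obtain ⟨i, hi⟩ : ∃ i, X (σ i) ≠ Y i := by
    by_contra hall
    push Not at hall
    have hXY : X ∘ σ = Y := funext hall
    rw [← hXY, srcCount_comp_perm] at h
    exact h rfl
  rw [prod_eq_zero (mem_univ i) (by rw [deltaMatrix_apply, if_neg hi]), smul_zero]

omit [Fintype Γ] in
/-- **Kernels of an element of `srcGE k` vanish at every family with fewer than `k` source legs.**
[cite: BenfattoGiulianiMastropietro2006, §2.9 (4.3)-(4.6)] -/
theorem kernel_eq_zero_of_mem_srcGE {k : ℕ} {F : GrassmannAlgebra R Γ} (hF : F ∈ srcGE R P k) {m : ℕ} {X : Fin m → Γ}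
    (hX : srcCount P X < k) : kernel R F m X = 0 := by
  induction hF using Submodule.span_induction with
  | mem x hx =>
    obtain ⟨n, Y, hY, rfl⟩ := hx
    by_cases hmn : m = n
    · subst hmn
      rw [kernel_genProd, det_deltaMatrix_eq_zero_of_srcCount_ne R P (fun h => by omega), mul_zero]
    · exact kernel_genProd_of_ne R X Y hmn
  | zero => exact kernel_zero_right R m X
  | add x y _ _ hx hy => rw [kernel_add, hx, hy, add_zero]
  | smul r x _ hx => rw [kernel_smul, hx, mul_zero]

/-- **An element all of whose kernels vanish at families with fewer than `k` source legs lies in `srcGE k`** (the kernel expansion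
`F = Σ_m Σ_Y kernel F m Y · ψ(Y)`). [cite: Salmhofer1999, §4.3 (4.95)] -/
theorem mem_srcGE_of_kernel_eq_zero {k : ℕ} {F : GrassmannAlgebra R Γ}
    (h : ∀ (m : ℕ) (X : Fin m → Γ), srcCount P X < k → kernel R F m X = 0) : F ∈ srcGE R P k := by
  rw [eq_sum_presented_kernel R F]
  refine Submodule.sum_mem _ fun m _ => ?_
  rw [presented]
  refine Submodule.sum_mem _ fun Y _ => ?_
  by_cases hY : srcCount P Y < k
  · rw [h m Y hY, zero_smul]
    exact Submodule.zero_mem _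
  · exact Submodule.smul_mem _ _ (genProd_mem_srcGE R P (not_lt.1 hY))

/-- **Membership in the source filtration is read off the kernels**: `F ∈ srcGE k` iff every kernel of `F` at a family with `< k`
source legs vanishes. [cite: BenfattoGiulianiMastropietro2006, §2.9 (4.3)-(4.6)] -/
theorem mem_srcGE_iff {k : ℕ} {F : GrassmannAlgebra R Γ} :
    F ∈ srcGE R P k ↔ ∀ (m : ℕ) (X : Fin m → Γ), srcCount P X < k → kernel R F m X = 0 :=
  ⟨fun hF _ _ hX => kernel_eq_zero_of_mem_srcGE R P hF hX, mem_srcGE_of_kernel_eq_zero R P⟩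

/-- In degree `0` the filtration is everything. [cite: BenfattoGiulianiMastropietro2006, §2.9 (4.3)-(4.6)] -/
theorem srcGE_zero : srcGE R P 0 = ⊤ :=
  eq_top_iff.2 fun _ _ => mem_srcGE_of_kernel_eq_zero R P fun _ _ h => absurd h (Nat.not_lt_zero _)

omit [Fintype Γ] in
/-- Two elements congruent modulo `srcGE k` have the same kernels at families with fewer than `k` source legs. [cite: BenfattoGiulianiMastropietro2006, §2.9 (4.3)-(4.6)] -/
theorem kernel_eq_kernel_of_sub_mem_srcGE {k : ℕ} {F G : GrassmannAlgebra R Γ} (h : F - G ∈ srcGE R P k) {m : ℕ}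
    {X : Fin m → Γ} (hX : srcCount P X < k) : kernel R F m X = kernel R G m X := by
  have h0 := kernel_eq_zero_of_mem_srcGE R P h hX (m := m)
  rw [sub_eq_add_neg, kernel_add, show -G = (-1 : R) • G from (neg_one_smul R G).symm, kernel_smul] at h0
  linear_combination h0

omit [Fintype Γ] in
/-- `constPart` kills the source filtration in positive degree (every monomial there has a leg). [cite: BenfattoGiulianiMastropietro2006, §2.9 (4.3)-(4.6)] -/
theorem constPart_eq_zero_of_mem_srcGE {k : ℕ} (hk : 1 ≤ k) {F : GrassmannAlgebra R Γ} (hF : F ∈ srcGE R P k) :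
    constPart R F = 0 := by
  rw [← kernel_zero R F Fin.elim0]
  exact kernel_eq_zero_of_mem_srcGE R P hF (by rw [srcCount_fin_zero]; exact hk)

/-! ### §3 `srcGE k` is a two-sided ideal -/

/-- **`srcGE k` is a left ideal**: multiplying by anything on the left cannot remove source legs. [cite: BenfattoGiulianiMastropietro2006, §2.9 (4.3)-(4.6)] -/
theorem mul_mem_srcGE {k : ℕ} (a : GrassmannAlgebra R Γ) {F : GrassmannAlgebra R Γ} (hF : F ∈ srcGE R P k) :
    a * F ∈ srcGE R P k := by
  induction hF using Submodule.span_induction with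
  | mem x hx =>
    obtain ⟨n, Y, hY, rfl⟩ := hx
    rw [eq_sum_presented_kernel R a, sum_mul]
    refine Submodule.sum_mem _ fun m _ => ?_
    rw [presented, sum_mul]
    refine Submodule.sum_mem _ fun X _ => ?_
    rw [smul_mul_assoc, ← genProd_append]
    exact Submodule.smul_mem _ _ (genProd_mem_srcGE R P (by rw [srcCount_append]; exact le_add_left hY))
  | zero => rw [mul_zero]; exact Submodule.zero_mem _
  | add x y _ _ hx hy => rw [mul_add]; exact Submodule.add_mem _ hx hy
  | smul r x _ hx => rw [mul_smul_comm]; exact Submodule.smul_mem _ r hx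

/-- **`srcGE k` is a right ideal.** [cite: BenfattoGiulianiMastropietro2006, §2.9 (4.3)-(4.6)] -/
theorem mul_mem_srcGE' {k : ℕ} (a : GrassmannAlgebra R Γ) {F : GrassmannAlgebra R Γ} (hF : F ∈ srcGE R P k) :
    F * a ∈ srcGE R P k := by
  induction hF using Submodule.span_induction with
  | mem x hx =>
    obtain ⟨n, Y, hY, rfl⟩ := hx
    rw [eq_sum_presented_kernel R a, mul_sum]
    refine Submodule.sum_mem _ fun m _ => ?_
    rw [presented, mul_sum]
    refine Submodule.sum_mem _ fun X _ => ?_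
    rw [mul_smul_comm, ← genProd_append]
    exact Submodule.smul_mem _ _ (genProd_mem_srcGE R P (by rw [srcCount_append]; exact le_add_right hY))
  | zero => rw [zero_mul]; exact Submodule.zero_mem _
  | add x y _ _ hx hy => rw [add_mul]; exact Submodule.add_mem _ hx hy
  | smul r x _ hx => rw [smul_mul_assoc]; exact Submodule.smul_mem _ r hx

/-- Powers of congruent elements are congruent modulo the ideal. [folklore] -/
private theorem pow_sub_pow_mem_srcGE {k : ℕ} {x y : GrassmannAlgebra R Γ} (h : x - y ∈ srcGE R P k) (n : ℕ) :
    x ^ n - y ^ n ∈ srcGE R P k := by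
  induction n with
  | zero => rw [pow_zero, pow_zero, sub_self]; exact Submodule.zero_mem _
  | succ n ih =>
    have hxy : x ^ (n + 1) - y ^ (n + 1) = x * (x ^ n - y ^ n) + (x - y) * y ^ n := by
      rw [pow_succ', pow_succ', mul_sub, sub_mul]; abel
    rw [hxy]
    exact Submodule.add_mem _ (mul_mem_srcGE R P x ih) (mul_mem_srcGE' R P _ h)

/-! ### §4 Stability under derivatives in non-source directions, the Laplacian and the Gaussian convolution -/

omit [Algebra ℚ R] [Fintype Γ] in
/-- A left derivative in a NON-source direction preserves `srcGE k` (it removes a non-source leg). [cite: BenfattoGiulianiMastropietro2006, §2.9 (4.3)-(4.6)] -/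
theorem grassmannDeriv_mem_srcGE {k : ℕ} {a : Γ} (ha : ¬ P a) {F : GrassmannAlgebra R Γ} (hF : F ∈ srcGE R P k) :
    grassmannDeriv R a F ∈ srcGE R P k := by
  induction hF using Submodule.span_induction with
  | mem x hx =>
    obtain ⟨n, Y, hY, rfl⟩ := hx
    cases n with
    | zero => rw [genProd_zero, grassmannDeriv_one]; exact Submodule.zero_mem _
    | succ n =>
      rw [grassmannDeriv_genProd]
      refine Submodule.sum_mem _ fun j _ => ?_
      by_cases hj : a = Y j
      · rw [if_pos hj]
        refine Submodule.smul_mem _ _ (genProd_mem_srcGE R P ?_)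
        rw [srcCount_comp_succAbove_of_not P Y j (by rw [← hj]; exact ha)]
        exact hY
      · rw [if_neg hj]; exact Submodule.zero_mem _
  | zero => rw [map_zero]; exact Submodule.zero_mem _
  | add x y _ _ hx hy => rw [map_add]; exact Submodule.add_mem _ hx hy
  | smul r x _ hx => rw [map_smul]; exact Submodule.smul_mem _ r hx

/-- **The fermionic Laplacian of a covariance VANISHING ON THE SOURCES preserves `srcGE k`** (`Δ_C = ½ Σ C(X,Y) ∂_X ∂_Y` only
removes pairs of non-source legs: the sources are spectators of the integration). [cite: BenfattoGiulianiMastropietro2006, §2.9 (4.3)-(4.6)] -/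
theorem grassmannLaplacian_mem_srcGE {k : ℕ} (C : Matrix Γ Γ R) (hC : ∀ X Y, P X ∨ P Y → C X Y = 0)
    {F : GrassmannAlgebra R Γ} (hF : F ∈ srcGE R P k) : grassmannLaplacian R C F ∈ srcGE R P k := by
  rw [grassmannLaplacian_apply]
  refine Submodule.smul_mem _ _ (Submodule.sum_mem _ fun X _ => Submodule.sum_mem _ fun Y _ => ?_)
  by_cases h : P X ∨ P Y
  · rw [hC X Y h, zero_smul]; exact Submodule.zero_mem _
  · push Not at h
    exact Submodule.smul_mem _ _ (grassmannDeriv_mem_srcGE R P h.1 (grassmannDeriv_mem_srcGE R P h.2 hF))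

omit [Algebra ℚ R] [Fintype Γ] in
/-- Powers of an endomorphism preserving `srcGE k` preserve it. [folklore] -/
private theorem pow_apply_mem_srcGE {k : ℕ} {T : Module.End R (GrassmannAlgebra R Γ)} (hT : ∀ F ∈ srcGE R P k, T F ∈ srcGE R P k)
    (n : ℕ) {F : GrassmannAlgebra R Γ} (hF : F ∈ srcGE R P k) : (T ^ n) F ∈ srcGE R P k := by
  induction n with
  | zero => simpa using hF
  | succ n ih => rw [pow_succ', Module.End.mul_apply]; exact hT _ ih

omit [Fintype Γ] in
/-- The exponential of a nilpotent endomorphism preserving `srcGE k` preserves it. [folklore] -/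
private theorem exp_apply_mem_srcGE {k : ℕ} {T : Module.End R (GrassmannAlgebra R Γ)} (hTn : IsNilpotent T)
    (hT : ∀ F ∈ srcGE R P k, T F ∈ srcGE R P k) {F : GrassmannAlgebra R Γ} (hF : F ∈ srcGE R P k) :
    IsNilpotent.exp T F ∈ srcGE R P k := by
  obtain ⟨n, hn⟩ := hTn
  rw [IsNilpotent.exp_eq_sum hn]
  simp only [LinearMap.coe_sum, Finset.sum_apply, LinearMap.smul_apply]
  refine Submodule.sum_mem _ fun i _ => ?_
  rw [← algebraMap_smul R]
  exact Submodule.smul_mem _ _ (pow_apply_mem_srcGE R P hT i hF)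

/-- **The Gaussian convolution `μ_C ⋆ = e^{Δ_C}` of a covariance vanishing on the sources preserves `srcGE k`.**
[cite: BenfattoGiulianiMastropietro2006, §2.9 (4.3)-(4.6)] -/
theorem gaussConv_mem_srcGE {k : ℕ} (C : Matrix Γ Γ R) (hC : ∀ X Y, P X ∨ P Y → C X Y = 0)
    {F : GrassmannAlgebra R Γ} (hF : F ∈ srcGE R P k) : gaussConv R C F ∈ srcGE R P k := by
  rw [gaussConv_def]
  exact exp_apply_mem_srcGE R P (isNilpotent_grassmannLaplacian R C) (fun G hG => grassmannLaplacian_mem_srcGE R P C hC hG) hF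

/-! ### §5 Congruences modulo `srcGE k`: exponential, logarithm, Boltzmann factor, partition function, effective action -/

/-- Truncated exponentials of congruent elements without constant part are congruent. [cite: BenfattoGiulianiMastropietro2006, §2.9 (4.3)-(4.6)] -/
theorem grassmannExp_sub_grassmannExp_mem_srcGE {k : ℕ} {x y : GrassmannAlgebra R Γ} (hx : constPart R x = 0)
    (hy : constPart R y = 0) (h : x - y ∈ srcGE R P k) : grassmannExp x - grassmannExp y ∈ srcGE R P k := by
  rw [grassmannExp, grassmannExp, IsNilpotent.exp_eq_sum (pow_card_succ_eq_zero_of_constPart_eq_zero R hx),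
    IsNilpotent.exp_eq_sum (pow_card_succ_eq_zero_of_constPart_eq_zero R hy), ← sum_sub_distrib]
  refine Submodule.sum_mem _ fun i _ => ?_
  rw [← smul_sub, ← algebraMap_smul R]
  exact Submodule.smul_mem _ _ (pow_sub_pow_mem_srcGE R P h i)

/-- Truncated logarithms of congruent elements without constant part are congruent. [cite: BenfattoGiulianiMastropietro2006, §2.9 (4.3)-(4.6)] -/
theorem grassmannLog1p_sub_grassmannLog1p_mem_srcGE {k : ℕ} {x y : GrassmannAlgebra R Γ} (hx : constPart R x = 0)
    (hy : constPart R y = 0) (h : x - y ∈ srcGE R P k) : grassmannLog1p R x - grassmannLog1p R y ∈ srcGE R P k := by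
  rw [grassmannLog1p_eq_sum R (pow_card_succ_eq_zero_of_constPart_eq_zero R hx),
    grassmannLog1p_eq_sum R (pow_card_succ_eq_zero_of_constPart_eq_zero R hy), ← sum_sub_distrib]
  refine Submodule.sum_mem _ fun i _ => ?_
  rw [← smul_sub, ← algebraMap_smul R]
  exact Submodule.smul_mem _ _ (pow_sub_pow_mem_srcGE R P h i)

variable (C : Matrix Γ Γ R)

/-- **Effective Boltzmann factors of congruent interactions are congruent** (`μ_C ⋆ e^{-V}` with `C` vanishing on the sources).
[cite: BenfattoGiulianiMastropietro2006, §2.9 (4.3)-(4.6)] -/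
theorem effBoltzmann_sub_effBoltzmann_mem_srcGE (hC : ∀ X Y, P X ∨ P Y → C X Y = 0) {k : ℕ} {V V' : GrassmannAlgebra R Γ}
    (hV : constPart R V = 0) (hV' : constPart R V' = 0) (h : V - V' ∈ srcGE R P k) :
    effBoltzmann R C V - effBoltzmann R C V' ∈ srcGE R P k := by
  rw [effBoltzmann_def, effBoltzmann_def, ← map_sub]
  refine gaussConv_mem_srcGE R P C hC (grassmannExp_sub_grassmannExp_mem_srcGE R P (by rw [map_neg, hV, neg_zero])
    (by rw [map_neg, hV', neg_zero]) ?_)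
  rw [neg_sub_neg, ← neg_sub]
  exact Submodule.neg_mem _ h

/-- **The partition function does not see the sources**: `Z(V) = Z(V')` for `V ≡ V'` modulo `srcGE k`, `k ≥ 1`.
[cite: BenfattoGiulianiMastropietro2006, §2.9 (4.3)-(4.6)] -/
theorem effPartitionFn_eq_of_sub_mem_srcGE (hC : ∀ X Y, P X ∨ P Y → C X Y = 0) {k : ℕ} (hk : 1 ≤ k)
    {V V' : GrassmannAlgebra R Γ} (hV : constPart R V = 0) (hV' : constPart R V' = 0) (h : V - V' ∈ srcGE R P k) :
    effPartitionFn R C V = effPartitionFn R C V' := by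
  rw [effPartitionFn, effPartitionFn, ← sub_eq_zero, ← map_sub]
  exact constPart_eq_zero_of_mem_srcGE R P hk (effBoltzmann_sub_effBoltzmann_mem_srcGE R P C hC hV hV' h)

/-- **The effective action respects the source filtration**: for a covariance vanishing on the sources and interactions without
constant part, `V - V' ∈ srcGE P k ⟹ effAction C V - effAction C V' ∈ srcGE P k` — the part of the effective action of source
degree `< k` depends only on the part of the interaction of source degree `< k` (BGM 2006, §2.9: the terms `W_R` with ≥ 3 external
fields never feed back into `𝒱^{(h)}`, `ℬ^{(h)}`). [cite: BenfattoGiulianiMastropietro2006, §2.9 (4.3)-(4.6)] -/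
theorem effAction_sub_effAction_mem_srcGE (hC : ∀ X Y, P X ∨ P Y → C X Y = 0) {k : ℕ} {V V' : GrassmannAlgebra R Γ}
    (hV : constPart R V = 0) (hV' : constPart R V' = 0) (h : V - V' ∈ srcGE R P k) :
    effAction R C V - effAction R C V' ∈ srcGE R P k := by
  rcases Nat.eq_zero_or_pos k with rfl | hk
  · rw [srcGE_zero]; exact Submodule.mem_top
  have hZ := effPartitionFn_eq_of_sub_mem_srcGE R P C hC hk hV hV' h
  rw [effAction_def, effAction_def, hZ, neg_sub_neg]
  by_cases hu : IsUnit (effPartitionFn R C V')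
  · have hB : effBoltzmann R C V' - effBoltzmann R C V ∈ srcGE R P k :=
      effBoltzmann_sub_effBoltzmann_mem_srcGE R P C hC hV' hV (by rw [← neg_sub]; exact Submodule.neg_mem _ h)
    refine grassmannLog1p_sub_grassmannLog1p_mem_srcGE R P ?_ ?_ ?_
    · rw [map_sub, map_smul, map_one, smul_eq_mul, ← effPartitionFn, Ring.inverse_mul_cancel _ hu, sub_self]
    · rw [map_sub, map_smul, map_one, smul_eq_mul, ← effPartitionFn, hZ, Ring.inverse_mul_cancel _ hu, sub_self]
    · rw [sub_sub_sub_cancel_right, ← smul_sub]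
      exact Submodule.smul_mem _ _ hB
  · rw [Ring.inverse_non_unit _ hu, zero_smul, zero_smul, sub_self]
    exact Submodule.zero_mem _

/-! ### §6 Stability under substitutions sending sources to sources -/

variable {Γ' : Type*} [Fintype Γ'] [DecidableEq Γ'] (P' : Γ' → Prop) [DecidablePred P']

omit [Algebra ℚ R] in
/-- **A substitution whose matrix sends source generators to source generators only preserves the source filtration** (across two
label types; alive generators may pick up source components — the doubling `ψ ↦ ψ + φ`, the dressing `ψ ↦ ψ + Gφ`, a re-sectorisation
of the alive legs, a rescaling of the sources). [cite: BenfattoGiulianiMastropietro2006, §2.9 (4.3)-(4.6)] -/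
theorem map_mem_srcGE (f : (Γ → R) →ₗ[R] (Γ' → R)) (hf : ∀ (X : Γ) (X' : Γ'), P X → ¬ P' X' → LinearMap.toMatrix' f X' X = 0)
    {k : ℕ} {F : GrassmannAlgebra R Γ} (hF : F ∈ srcGE R P k) : ExteriorAlgebra.map f F ∈ srcGE R P' k := by
  induction hF using Submodule.span_induction with
  | mem x hx =>
    obtain ⟨n, Y, hY, rfl⟩ := hx
    rw [map_genProd_eq_sum]
    refine Submodule.sum_mem _ fun Y' _ => ?_
    by_cases h0 : (∏ i, LinearMap.toMatrix' f (Y' i) (Y i)) = 0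
    · rw [h0, zero_smul]; exact Submodule.zero_mem _
    · refine Submodule.smul_mem _ _ (genProd_mem_srcGE R P' (hY.trans (srcCount_le_of_forall P P' Y Y' fun i hi => ?_)))
      by_contra hn
      exact h0 (prod_eq_zero (mem_univ i) (hf _ _ hi hn))
  | zero => rw [map_zero]; exact Submodule.zero_mem _
  | add x y _ _ hx hy => rw [map_add]; exact Submodule.add_mem _ hx hy
  | smul r x _ hx => rw [map_smul]; exact Submodule.smul_mem _ r hx

omit [Algebra ℚ R] in
/-- Congruence form of `map_mem_srcGE`. [cite: BenfattoGiulianiMastropietro2006, §2.9 (4.3)-(4.6)] -/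
theorem map_sub_map_mem_srcGE (f : (Γ → R) →ₗ[R] (Γ' → R)) (hf : ∀ (X : Γ) (X' : Γ'), P X → ¬ P' X' → LinearMap.toMatrix' f X' X = 0)
    {k : ℕ} {F G : GrassmannAlgebra R Γ} (h : F - G ∈ srcGE R P k) :
    ExteriorAlgebra.map f F - ExteriorAlgebra.map f G ∈ srcGE R P' k := by
  rw [← map_sub]
  exact map_mem_srcGE R P P' f hf h

/-! ### §7 The truncation to source degree `< k` -/

/-- **The truncation of `F` to source degree `< k`**: the monomials with fewer than `k` source legs, with their kernels
(for `k = 3`: the terms of order `≤ 2` in the external field, `𝒱^{(h)} + ℬ^{(h)}` without `W_R` in BGM 2006, (4.3)).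
[cite: BenfattoGiulianiMastropietro2006, §2.9 (4.3)-(4.6)] -/
def srcTrunc (k : ℕ) (F : GrassmannAlgebra R Γ) : GrassmannAlgebra R Γ :=
  ∑ m ∈ range (Fintype.card Γ + 1), presented R (fun X : Fin m → Γ => if srcCount P X < k then kernel R F m X else 0)

/-- **The kernels of the truncation**: `kernel (srcTrunc k F) m X = [srcCount X < k] · kernel F m X`. [cite: Salmhofer1999, §4.3 (4.95)] -/
theorem kernel_srcTrunc (k : ℕ) (F : GrassmannAlgebra R Γ) (m : ℕ) (X : Fin m → Γ) :
    kernel R (srcTrunc R P k F) m X = if srcCount P X < k then kernel R F m X else 0 := by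
  rw [srcTrunc, kernel_sum]
  by_cases hm : m ∈ range (Fintype.card Γ + 1)
  · rw [sum_eq_single_of_mem m hm (fun n _ hn => kernel_presented_of_ne R _ X (Ne.symm hn)), kernel_presented]
    have hc : ((m.factorial : ℚ)⁻¹ • (1 : R)) * ((m.factorial : ℕ) : R) = 1 := by
      rw [← mul_one ((m.factorial : ℕ) : R), ← nsmul_eq_mul, ← Nat.cast_smul_eq_nsmul ℚ, smul_mul_smul_comm,
        one_mul, inv_mul_cancel₀ (by positivity), one_smul]
    -- the predicate is permutation invariant and the kernel is antisymmetric
    have hσ : ∀ σ : Equiv.Perm (Fin m), Equiv.Perm.sign σ • (fun X : Fin m → Γ => if srcCount P X < k then kernel R F m X else 0) (X ∘ σ) =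
        if srcCount P X < k then kernel R F m X else 0 := by
      intro σ
      simp only [srcCount_comp_perm]
      by_cases h : srcCount P X < k
      · rw [if_pos h, if_pos h, kernel_comp_perm R F m X σ, Units.smul_def, zsmul_eq_mul, ← mul_assoc, ← Int.cast_mul,
          Int.units_coe_mul_self, Int.cast_one, one_mul]
      · rw [if_neg h, if_neg h, smul_zero]
    rw [sum_congr rfl fun σ _ => hσ σ, sum_const, card_univ, Fintype.card_perm, Fintype.card_fin, nsmul_eq_mul, ← mul_assoc, hc,
      one_mul]
  · have hlt : Fintype.card Γ < m := by rw [mem_range] at hm; omega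
    rw [sum_eq_zero fun n hn => kernel_presented_of_ne R _ X (by rintro rfl; exact hm hn), kernel_eq_zero_of_card_lt R F hlt, ite_self]

/-- Below source degree `k` the truncation has the kernels of `F`. [cite: Salmhofer1999, §4.3 (4.95)] -/
theorem kernel_srcTrunc_of_lt {k : ℕ} (F : GrassmannAlgebra R Γ) {m : ℕ} {X : Fin m → Γ} (hX : srcCount P X < k) :
    kernel R (srcTrunc R P k F) m X = kernel R F m X := by
  rw [kernel_srcTrunc, if_pos hX]

/-- At and above source degree `k` the truncation has no kernels. [cite: Salmhofer1999, §4.3 (4.95)] -/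
theorem kernel_srcTrunc_of_le {k : ℕ} (F : GrassmannAlgebra R Γ) {m : ℕ} {X : Fin m → Γ} (hX : k ≤ srcCount P X) :
    kernel R (srcTrunc R P k F) m X = 0 := by
  rw [kernel_srcTrunc, if_neg (not_lt.2 hX)]

/-- An element is determined by its kernels. [cite: Salmhofer1999, §4.3 (4.95)] -/
private theorem eq_of_kernel_eq {F G : GrassmannAlgebra R Γ} (h : ∀ (m : ℕ) (X : Fin m → Γ), kernel R F m X = kernel R G m X) : F = G := by
  rw [eq_sum_presented_kernel R F, eq_sum_presented_kernel R G]
  exact sum_congr rfl fun m _ => by rw [show kernel R F m = kernel R G m from funext (h m)]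

/-- The truncation is additive. [cite: Salmhofer1999, §4.3 (4.95)] -/
theorem srcTrunc_add (k : ℕ) (F G : GrassmannAlgebra R Γ) : srcTrunc R P k (F + G) = srcTrunc R P k F + srcTrunc R P k G :=
  eq_of_kernel_eq R fun m X => by
    rw [kernel_add, kernel_srcTrunc, kernel_srcTrunc, kernel_srcTrunc, kernel_add]
    split_ifs <;> simp

/-- The truncation is homogeneous. [cite: Salmhofer1999, §4.3 (4.95)] -/
theorem srcTrunc_smul (k : ℕ) (r : R) (F : GrassmannAlgebra R Γ) : srcTrunc R P k (r • F) = r • srcTrunc R P k F :=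
  eq_of_kernel_eq R fun m X => by
    rw [kernel_smul, kernel_srcTrunc, kernel_srcTrunc, kernel_smul]
    split_ifs <;> simp

/-- The truncation of a difference. [cite: Salmhofer1999, §4.3 (4.95)] -/
theorem srcTrunc_sub (k : ℕ) (F G : GrassmannAlgebra R Γ) : srcTrunc R P k (F - G) = srcTrunc R P k F - srcTrunc R P k G := by
  rw [sub_eq_add_neg, srcTrunc_add, show -G = (-1 : R) • G from (neg_one_smul R G).symm, srcTrunc_smul, neg_one_smul,
    sub_eq_add_neg]

/-- **What the truncation drops lies in `srcGE k`**: `F - srcTrunc k F ∈ srcGE k`. [cite: BenfattoGiulianiMastropietro2006, §2.9 (4.3)-(4.6)] -/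
theorem sub_srcTrunc_mem_srcGE (k : ℕ) (F : GrassmannAlgebra R Γ) : F - srcTrunc R P k F ∈ srcGE R P k :=
  mem_srcGE_of_kernel_eq_zero R P fun m X hX => by
    rw [sub_eq_add_neg, kernel_add, show -srcTrunc R P k F = (-1 : R) • srcTrunc R P k F from (neg_one_smul R _).symm,
      kernel_smul, kernel_srcTrunc_of_lt R P F hX, neg_one_mul, add_neg_cancel]

/-- The truncation kills `srcGE k`. [cite: BenfattoGiulianiMastropietro2006, §2.9 (4.3)-(4.6)] -/
theorem srcTrunc_eq_zero_of_mem {k : ℕ} {F : GrassmannAlgebra R Γ} (hF : F ∈ srcGE R P k) : srcTrunc R P k F = 0 :=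
  eq_of_kernel_eq R fun m X => by
    rw [kernel_srcTrunc, kernel_zero_right]
    split_ifs with h
    · exact kernel_eq_zero_of_mem_srcGE R P hF h
    · rfl

/-- The truncation of the truncation. [cite: Salmhofer1999, §4.3 (4.95)] -/
theorem srcTrunc_srcTrunc (k : ℕ) (F : GrassmannAlgebra R Γ) : srcTrunc R P k (srcTrunc R P k F) = srcTrunc R P k F :=
  eq_of_kernel_eq R fun m X => by
    rw [kernel_srcTrunc, kernel_srcTrunc]
    split_ifs <;> rfl

/-- **Two elements have the same truncation iff they are congruent modulo `srcGE k`.** [cite: BenfattoGiulianiMastropietro2006, §2.9 (4.3)-(4.6)] -/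
theorem srcTrunc_eq_srcTrunc_iff {k : ℕ} {F G : GrassmannAlgebra R Γ} : srcTrunc R P k F = srcTrunc R P k G ↔ F - G ∈ srcGE R P k := by
  constructor
  · intro h
    have hFG : F - G = (F - srcTrunc R P k F) - (G - srcTrunc R P k G) := by rw [h]; abel
    rw [hFG]
    exact Submodule.sub_mem _ (sub_srcTrunc_mem_srcGE R P k F) (sub_srcTrunc_mem_srcGE R P k G)
  · intro h
    rw [← sub_eq_zero, ← srcTrunc_sub]
    exact srcTrunc_eq_zero_of_mem R P h

/-- In degree `0` the truncation is zero. [cite: Salmhofer1999, §4.3 (4.95)] -/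
theorem srcTrunc_zero_left (F : GrassmannAlgebra R Γ) : srcTrunc R P 0 F = 0 :=
  srcTrunc_eq_zero_of_mem R P (by rw [srcGE_zero]; exact Submodule.mem_top)

/-- The constant part of the truncation (`k ≥ 1`) is that of `F`. [cite: Salmhofer1999, §4.3 (4.95)] -/
theorem constPart_srcTrunc {k : ℕ} (hk : 1 ≤ k) (F : GrassmannAlgebra R Γ) : constPart R (srcTrunc R P k F) = constPart R F := by
  rw [← kernel_zero R (srcTrunc R P k F) Fin.elim0, kernel_srcTrunc_of_lt R P F (by rw [srcCount_fin_zero]; exact hk), kernel_zero]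

/-- An interaction without constant part has a truncation without constant part. [cite: Salmhofer1999, §4.3 (4.95)] -/
theorem constPart_srcTrunc_eq_zero (k : ℕ) {F : GrassmannAlgebra R Γ} (hF : constPart R F = 0) : constPart R (srcTrunc R P k F) = 0 := by
  rcases Nat.eq_zero_or_pos k with rfl | hk
  · rw [srcTrunc_zero_left, map_zero]
  · rw [constPart_srcTrunc R P hk, hF]

/-- The truncation of an even element is even. [cite: Salmhofer1999, §4.3 (4.95)] -/
theorem srcTrunc_mem_evenPart (k : ℕ) {F : GrassmannAlgebra R Γ} (hF : F ∈ evenPart R Γ) : srcTrunc R P k F ∈ evenPart R Γ := by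
  refine Subalgebra.sum_mem _ fun m _ => ?_
  rcases Nat.even_or_odd m with he | ho
  · refine Submodule.sum_mem _ fun Y _ => Submodule.smul_mem _ _ ?_
    have h := genProd_mem_evenOdd R Y
    rwa [(ZMod.natCast_eq_zero_iff_even).2 he] at h
  · have h0 : (fun X : Fin m → Γ => if srcCount P X < k then kernel R F m X else 0) = 0 :=
      funext fun X => by simp [kernel_eq_zero_of_mem_evenPart_of_odd R hF ho X]
    rw [h0, presented_zero]
    exact zero_mem _

/-- **The single-scale step may be run on the truncated input**: `srcTrunc k (effAction C (srcTrunc k V)) = srcTrunc k (effAction C V)`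
for a covariance vanishing on the sources and `V` without constant part — the source-degree-`< k` part of the effective action is a
function of the source-degree-`< k` part of the interaction (BGM 2006, §2.9: the recursion for `𝒱^{(h)} + ℬ^{(h)}` closes on itself).
[cite: BenfattoGiulianiMastropietro2006, §2.9 (4.3)-(4.6)] -/
theorem srcTrunc_effAction_srcTrunc (hC : ∀ X Y, P X ∨ P Y → C X Y = 0) (k : ℕ) {V : GrassmannAlgebra R Γ} (hV : constPart R V = 0) :
    srcTrunc R P k (effAction R C (srcTrunc R P k V)) = srcTrunc R P k (effAction R C V) :=
  (srcTrunc_eq_srcTrunc_iff R P).2 (effAction_sub_effAction_mem_srcGE R P C hC (constPart_srcTrunc_eq_zero R P k hV) hV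
    (by rw [← neg_sub]; exact Submodule.neg_mem _ (sub_srcTrunc_mem_srcGE R P k V)))

/-- The partition function of the truncated interaction (`k ≥ 1`). [cite: BenfattoGiulianiMastropietro2006, §2.9 (4.3)-(4.6)] -/
theorem effPartitionFn_srcTrunc (hC : ∀ X Y, P X ∨ P Y → C X Y = 0) {k : ℕ} (hk : 1 ≤ k) {V : GrassmannAlgebra R Γ}
    (hV : constPart R V = 0) : effPartitionFn R C (srcTrunc R P k V) = effPartitionFn R C V :=
  effPartitionFn_eq_of_sub_mem_srcGE R P C hC hk (constPart_srcTrunc_eq_zero R P k hV) hV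
    (by rw [← neg_sub]; exact Submodule.neg_mem _ (sub_srcTrunc_mem_srcGE R P k V))

/-- **Substitutions may be run on the truncated input**: `srcTrunc k (map f (srcTrunc k F)) = srcTrunc k (map f F)` for a substitution
sending sources to sources only (two label types). [cite: BenfattoGiulianiMastropietro2006, §2.9 (4.3)-(4.6)] -/
theorem srcTrunc_map_srcTrunc (f : (Γ → R) →ₗ[R] (Γ' → R)) (hf : ∀ (X : Γ) (X' : Γ'), P X → ¬ P' X' → LinearMap.toMatrix' f X' X = 0)
    (k : ℕ) (F : GrassmannAlgebra R Γ) :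
    srcTrunc R P' k (ExteriorAlgebra.map f (srcTrunc R P k F)) = srcTrunc R P' k (ExteriorAlgebra.map f F) :=
  (srcTrunc_eq_srcTrunc_iff R P').2 (map_sub_map_mem_srcGE R P P' f hf
    (by rw [← neg_sub]; exact Submodule.neg_mem _ (sub_srcTrunc_mem_srcGE R P k F)))

/-- **One scale of the source-truncated flow**: truncating after «substitution ∘ single-scale step» is insensitive to truncating
before it. [cite: BenfattoGiulianiMastropietro2006, §2.9 (4.3)-(4.6)] -/
theorem srcTrunc_map_effAction_srcTrunc (hC : ∀ X Y, P X ∨ P Y → C X Y = 0) (f : (Γ → R) →ₗ[R] (Γ' → R))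
    (hf : ∀ (X : Γ) (X' : Γ'), P X → ¬ P' X' → LinearMap.toMatrix' f X' X = 0) (k : ℕ) {V : GrassmannAlgebra R Γ}
    (hV : constPart R V = 0) :
    srcTrunc R P' k (ExteriorAlgebra.map f (effAction R C (srcTrunc R P k V))) =
      srcTrunc R P' k (ExteriorAlgebra.map f (effAction R C V)) :=
  (srcTrunc_eq_srcTrunc_iff R P').2 (map_sub_map_mem_srcGE R P P' f hf
    (effAction_sub_effAction_mem_srcGE R P C hC (constPart_srcTrunc_eq_zero R P k hV) hV
      (by rw [← neg_sub]; exact Submodule.neg_mem _ (sub_srcTrunc_mem_srcGE R P k V))))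

end SrcGE

/-! ### §8 Profiles of the truncation (for the renormalisation-group consumers) -/

section Norms

variable {𝕜 : Type*} [RCLike 𝕜] {Γ : Type*} [Fintype Γ] [DecidableEq Γ] (P : Γ → Prop) [DecidablePred P]

/-- The kernels of the truncation are pointwise dominated by those of `F`. [folklore] -/
private theorem norm_kernel_srcTrunc_le (k : ℕ) (F : GrassmannAlgebra 𝕜 Γ) (m : ℕ) (X : Fin m → Γ) :
    ‖kernel 𝕜 (srcTrunc 𝕜 P k F) m X‖ ≤ ‖kernel 𝕜 F m X‖ := by
  rw [kernel_srcTrunc]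
  split_ifs
  · exact le_rfl
  · rw [norm_zero]; exact norm_nonneg _

/-- **Pinned weighted profiles of the truncation are dominated by those of `F`.** [cite: Salmhofer1999, §4.3 (4.95)] -/
theorem sum_filter_norm_kernel_srcTrunc_mul_le (k : ℕ) (F : GrassmannAlgebra 𝕜 Γ) (m : ℕ) (j : Fin m) (x : Γ)
    (wt : (Fin m → Γ) → ℝ) (hwt : ∀ Y, 0 ≤ wt Y) :
    ∑ Y ∈ univ.filter (fun Y : Fin m → Γ => Y j = x), ‖kernel 𝕜 (srcTrunc 𝕜 P k F) m Y‖ * wt Y ≤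
      ∑ Y ∈ univ.filter (fun Y : Fin m → Γ => Y j = x), ‖kernel 𝕜 F m Y‖ * wt Y :=
  sum_le_sum fun Y _ => mul_le_mul_of_nonneg_right (norm_kernel_srcTrunc_le P k F m Y) (hwt Y)

/-- **Weighted profiles over any finite set of families are dominated by those of `F`.** [cite: Salmhofer1999, §4.3 (4.95)] -/
theorem sum_norm_kernel_srcTrunc_mul_le (k : ℕ) (F : GrassmannAlgebra 𝕜 Γ) (m : ℕ) (s : Finset (Fin m → Γ))
    (wt : (Fin m → Γ) → ℝ) (hwt : ∀ Y, 0 ≤ wt Y) :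
    ∑ Y ∈ s, ‖kernel 𝕜 (srcTrunc 𝕜 P k F) m Y‖ * wt Y ≤ ∑ Y ∈ s, ‖kernel 𝕜 F m Y‖ * wt Y :=
  sum_le_sum fun Y _ => mul_le_mul_of_nonneg_right (norm_kernel_srcTrunc_le P k F m Y) (hwt Y)

end Norms

end Literature.MathematicalPhysics.QuantumLattice

end
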